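import Summits.ValiantsHypothesis.ValiantsHypothesis.Theorems.KSPipelineCeiling
import HarnessLib

/-!
# The Kumar–Saraf class transports along `0/1`-substitutions — at the SOURCE degree only
# (support for crux `Depth4HomFour` = item `stmt-ValiantsHypothesis-11333`; lens 4, g30, O23-β)

Typed form of the audit of the door's print record "homogeneous `ΣΠΣΠ` for `Det_n` has size
`2^{Ω(n^ε)}`" (Kumar–Saraf 2014/17 Cor. 1.4 = Kumar's thesis Cor. 4.4, justified in print by the
single sentence "det is complete for VQP", no proof in any version).  Homogeneous `ΣΠΣΠ` is NOT
closed under substituting the constant `1`, so the sentence does not transport the `IMM` bound;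
what does transport is the CERTIFICATE: the class `KSCertifies f M s T` (tree, `KSPipelineCeiling`)
quantifies the `0/1`-substitution `ρ_{J,V}` inside, and `0/1`-substitutions compose
(`substVars_substVars`), so a certificate for ANY image `ρ_{J₀,V₀} f` issued at the degree
parameter `M` is a certificate for `f` at the same `M` (★ `ksCertifies_of_subst`), hence sound for
`homDepthFourCircuitSize f` when `f` is homogeneous of degree `M`
(★ `le_homDepthFourCircuitSize_of_ksCertifies_subst`).  The parameter is the point: the merging
count `numSubsetsLE (2M/s+1) r` is monotone in `M` (the tree's `KumarSaraf.numSubsetsLE_mono`,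
USED BY NAME — the CALLed restatement `numSubsetsLE_mono` is refused by the gate as
`dedup.landed`), so the class is ANTItone in `M`
(`ksCertifies_anti`) — a certificate for the image `IMM = ρ(det_m)` must be issued at the SOURCE
degree `m = deg det_m`, not at `n = deg IMM`; issuing at the image's own smaller degree (what the
one-sentence reading silently assumes) is the STRONGER statement, and the gap is the factor
`numSubsetsLE (2m/s+1) r / numSubsetsLE (2n/s+1) r ≈ (m/n)^r`, of the order of the bound itself at
Kumar–Saraf's parameters.  HONESTY: bookkeeping inside the tree's `KSCore01` currency; proves no
lower bound, refutes nothing, 0 S-currency; Cor. 1.4 stays PRINT-CLAIMED (its repair = a KS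
analysis of a zero-pattern image of `det_m` at merging count `2m/s+1`, unperformed); crux 11333,
the fixed-slope window and `VP ≠ VNP` untouched.
-/

set_option linter.dupNamespace false

noncomputable section

open MvPolynomial Literature.Computability.AlgebraicComplexity
open Literature.Computability.AlgebraicComplexity.KumarSaraf
open Literature.Computability.AlgebraicComplexity.GKKS
open Summit.ValiantsHypothesis.ValiantsHypothesis.Theorems.KSPipelineCeiling

namespace Summit.ValiantsHypothesis.ValiantsHypothesis.Theorems.KSTransport

variable {K : Type} [Field K] {σ : Type} [Fintype σ] [DecidableEq σ]

omit [Fintype σ] in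
/-- Composition of two `0/1`-substitutions is a `0/1`-substitution. [folklore] -/
theorem substVars_substVars (J V J₀ V₀ : Finset σ) (f : MvPolynomial σ K) :
    substVars J V (substVars J₀ V₀ f) =
      substVars (J₀ ∪ ((V₀ \ J₀) ∩ J)) (((V₀ \ J₀) \ J) ∩ V) f := by
  have hcomp : (substVars J V).comp (substVars J₀ V₀) =
      substVars (k := K) (J₀ ∪ ((V₀ \ J₀) ∩ J)) (((V₀ \ J₀) \ J) ∩ V) := by
    refine MvPolynomial.algHom_ext fun v => ?_
    simp only [AlgHom.comp_apply, substVars, aeval_X]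
    by_cases h₀ : v ∈ J₀ <;> by_cases h₁ : v ∈ V₀ <;> by_cases h₂ : v ∈ J <;>
      by_cases h₃ : v ∈ V <;> simp [h₀, h₁, h₂, h₃]
  exact DFunLike.congr_fun hcomp f

/-- ★ **Closure of the KS class under `0/1`-substitution at FIXED degree parameter**: a certificate
for the image `ρ_{J₀,V₀} f` at parameter `M` is a certificate for `f` at parameter `M`.
[cite: KumarSaraf2017, §8.1 (the matrices `J`) and Thm. 8.10] -/
theorem ksCertifies_of_subst {f : MvPolynomial σ K} {J₀ V₀ : Finset σ} {M s T : ℕ}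
    (h : KSCertifies (substVars J₀ V₀ f) M s T) : KSCertifies f M s T := by
  intro B hB
  obtain ⟨J, V, r, m, L, hL, hV, hbig⟩ :=
    h (B.image fun A => (A \ J₀) ∩ V₀) (Finset.card_image_le.trans hB)
  refine ⟨J₀ ∪ ((V₀ \ J₀) ∩ J), ((V₀ \ J₀) \ J) ∩ V, r, m, L, hL, fun A hA hs hsub => ?_, ?_⟩
  · -- under `hsub`, the surviving non-`J'` variables of `A` are those of its image set
    have heq : A \ (J₀ ∪ ((V₀ \ J₀) ∩ J)) = ((A \ J₀) ∩ V₀) \ J := by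
      ext x
      have hx : x ∈ A \ (J₀ ∪ ((V₀ \ J₀) ∩ J)) → x ∈ ((V₀ \ J₀) \ J) ∩ V := fun hx => hsub hx
      simp only [Finset.mem_sdiff, Finset.mem_union, Finset.mem_inter] at hx ⊢
      tauto
    refine hV ((A \ J₀) ∩ V₀) (Finset.mem_image.2 ⟨A, hA, rfl⟩) (by rw [← heq]; exact hs)
      fun x hx => ?_
    rw [← heq] at hx
    exact (Finset.mem_inter.1 (hsub hx)).2
  · rwa [substVars_substVars] at hbig

/-- ★ **Transported soundness**: a KS certificate for any `0/1`-image of a homogeneous `f` of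
degree `M ≥ 2`, issued at parameter `M` (the SOURCE degree), bounds the homogeneous-`ΣΠΣΠ` size
of `f`. [cite: KumarSaraf2017, Thm. 8.10 (proof)] -/
theorem le_homDepthFourCircuitSize_of_ksCertifies_subst {f : MvPolynomial σ K}
    {J₀ V₀ : Finset σ} {M s T : ℕ} (hf : f.IsHomogeneous M) (hM : 2 ≤ M) (hs : 1 ≤ s)
    (h : KSCertifies (substVars J₀ V₀ f) M s T) :
    (T : ℕ∞) ≤ homDepthFourCircuitSize f :=
  le_homDepthFourCircuitSize_of_ksCertifies hf hM hs (ksCertifies_of_subst h)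

/-- The class is ANTItone in the degree parameter: a certificate at a larger parameter is
one at every smaller parameter — issuing at the image's own (smaller) degree is the STRONGER,
untransported statement. [folklore] -/
theorem ksCertifies_anti {f : MvPolynomial σ K} {M M' s T : ℕ} (hMM' : M ≤ M')
    (h : KSCertifies f M' s T) : KSCertifies f M s T := by
  intro B hB
  obtain ⟨J, V, r, m, L, hL, hV, hbig⟩ := h B hB
  refine ⟨J, V, r, m, L, hL, hV, lt_of_le_of_lt (Nat.mul_le_mul_left _ (Nat.mul_le_mul_right _
    (Literature.Computability.AlgebraicComplexity.KumarSaraf.numSubsetsLE_mono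
      (Nat.succ_le_succ (Nat.div_le_div_right (Nat.mul_le_mul_left 2 hMM'))) r))) hbig⟩

end Summit.ValiantsHypothesis.ValiantsHypothesis.Theorems.KSTransport

end
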